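import Mathlib
import Literature.MathematicalPhysics.QuantumFieldTheory.Balaban1983to89.B6
import Literature.MathematicalPhysics.QuantumFieldTheory.Balaban1983to89.B6RandomWalk

/-!
# `Balaban1983to89.B6Prop26` — [Balaban1984PropagatorsII] Proposition 2.6 (p. 247): the printed sentence
"Reasoning in the same way as in the proof of Proposition 2.2 we obtain Proposition 2.6" KERNEL-CHECKED for the
entries |(GJ)(x)|, |(∇GJ)(x)|, |(ΔGJ)(x)| of (2.136)

CITATION HEADER (lean-in-tree rule 2026-08-18).  Source: T. Bałaban, *Propagators and renormalization transformations
for lattice gauge theories. II*, Commun. Math. Phys. **96**, 223–250 (1984) [Balaban1984PropagatorsII] (cell paper B6;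
held: `paper:balaban1984-cmp96-propagators-rt-ii`; journal page = PDF page + 222; quotations below are read from the
page renders pp. 239, 247).  Satellite of the sibling modules `…Balaban1983to89.B6` (unit r1 / sub-cell b06) and
`…B6RandomWalk` (unit pv08), which it imports and does not modify; surge node T03.6 "sharpen" (Prop. 2.6), unit
`b2b-balaban-pv01`.

WHAT THE PAPER PRINTS.  p. 239 [PDF 17]: *"We form an approximation of G taking as usual G₀ = Σ_{□∈𝒟} h_□G_□h_□.
Using the formulas (1.126)–(1.128), we get Δ_aG₀ = I − Σ_{□,□′∈𝒟} K_{□,□′}G_{□′}h_{□′} = I − R, (2.91)"*.  p. 247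
[PDF 25]: *"|(G_□J)(x)|, |(∇G_□J)(x)| ≤ O(1)[(L^jη)², L^jη]e^{−δ₂(L^jη)^{−1}dist(Δ,Δ′)}|J|, (2.133) for x ∈ Δ(y),
supp J ⊂ Δ(y′), y, y′ ∈ 𝔅 ∩ T_□. Applying the inequalities (2.133), (2.88) and the remarks after the inequality (2.68)
we obtain |(K_{□,□′}G_{□′}h_{□′}J)(x)| ≤ O(M^{−1})e^{−½δ₂d(y,y′)}|J| (2.134) for x ∈ Δ(y), supp J ⊂ Δ(y′), and
this together with (2.91) implies |(RJ)(x)| ≤ O(M^{−1})e^{−½δ₂d(y,y′)}|J|, x ∈ Δ(y), supp J ⊂ Δ(y′). (2.135)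
Reasoning in the same way as in the proof of Proposition 2.2 we obtain **Proposition 2.6.** There exists a positive
constant δ₃ depending on d and L only, such that |(GJ)(x)|, |(∇GJ)(x)|, |(G∇*J)(x)|, |(ΔGJ)(x)| ≤ O(1)[(L^jη)²,
L^jη, L^jη, 1]e^{−δ₃d(y,y′)}|J| (2.136) for x ∈ Δ(y), y ∈ Λ_j, supp J ⊂ Δ(y′), with the constant O(1) depending
on d and L only; … The operator G can be represented as G = G₀(I − R)^{−1} = Σ_{n=0}^∞ G₀Rⁿ = Σ_{ω=(□₀,…,□_{2n})}
h_{□₀}G_{□₀}h_{□₀} · K_{□₁,□₂}G_{□₂}h_{□₂} · … · K_{□_{2n−1},□_{2n}}G_{□_{2n}}h_{□_{2n}}, (2.141) and the series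
above is convergent in the norms appearing in the inequalities (2.136)–(2.140)."*  The "proof of Proposition 2.2"
referred to is the random-walk chain (2.50)/(2.64)–(2.66) p. 234, KERNEL-CHECKED in `…B6RandomWalk` (unit pv08) as
`B6RandomWalk.majorant_of_fixedPoint_266`: any linear operator G′ on the functions on a finite lattice with
G′ = G′₀ + G′R, G′₀ of block majorant A·P(y)·e^{−δd(y,y′)} and R of block majorant θe^{−δd(y,y′)}, has — under the
located smallness θc₁(α) < 1 and Lemma 2.1 at rate δ — the block majorant A c₁(α)(1 − θc₁(α))^{−1} P(y)
e^{−(1−α)δd(y,y′)}.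

WHAT IS REPRODUCED HERE (kernel-checked; every analytic input an explicit hypothesis quoting its printed source, the
"proof of Prop. 2.2" invoked BY NAME from `…B6RandomWalk`, not duplicated): (1) `fixedPoint_of_291` — pure algebra:
(2.91) `Δ_a G₀ = I − R` together with `G Δ_a = I` (G = Δ_a^{−1}) gives the fixed-point form `G = G₀ + G R` of
(2.141); `left_mul_fixedPoint` — for EVERY left factor D (D = I, ∇_μ, Δ: the entries |GJ|, |∇GJ|, |ΔGJ| of (2.136))
`DG = DG₀ + (DG)R`; (2) `prop26_entry_of_291` — hence, by `B6RandomWalk.majorant_of_fixedPoint_266`, a block majorant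
`A·P(y)·e^{−δd}` of DG₀ ((2.133) summed over the boxes — HYPOTHESIS) and the majorant `θe^{−δd}` of R ((2.135),
θ = O(M^{−1}) — HYPOTHESIS) give the majorant `A c₁(α)(1 − θc₁(α))^{−1} P(y) e^{−(1−α)δ d(y,y′)}` of DG: the printed
(2.136) entry with δ₃ = (1−α)δ and O(1) = A c₁(α)(1 − θc₁(α))^{−1} EXPLICIT, valid exactly under θc₁(α) < 1 ("M
sufficiently large": `M₁ ≤ M` in `B6.Prop26Printed`); (3) `prop26_entry_of_lemma21` — the same over a geometry of a
family satisfying the tree's typed Lemma 2.1 `B6.Lemma21Printed d δ geo` + the triangle inequality (2.54), with (2.61),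
(2.63) DISCHARGED (`B6RandomWalk.ineq263_of_261`); (4) `prop26_three_entries_of_lemma21` — the entries n = 0, 1, 3 of
the printed table [(L^jη)², L^jη, ·, 1] (`B6.pref4`) simultaneously, for three left factors D₀ = 1, D₁, D₃.
WHAT IS *NOT* REPRODUCED OR ASSERTED: (2.133), (2.134), (2.135), (2.91) themselves (hypotheses only); the passage from
the PER-BOX bound (2.133) (scaled euclidean distance (L^jη)^{−1}dist(Δ,Δ′), y, y′ ∈ 𝔅 ∩ T_□) to a d-form block
majorant of G₀ = Σ_□ h_□G_□h_□ and of ∇G₀, ΔG₀ (partition {h_□}, comparison dist ↔ d: the reader's; cell GAPS.md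
G-pv01-5 (i), cf. G-pv08-1); the entry |(G∇*J)(x)| and (2.137)–(2.140) (they are NOT of the left-factor form DG —
the last factor of the series (2.141) changes; located, G-pv01-5 (iii)); "δ₃ depending on d and L only" beyond the
explicit formula δ₃ = (1−α)δ (it requires δ₂ = δ₂(d, L) of Prop. 2.5 and a fixed α).  NOTHING of the series is
asserted; value = typed skeleton + located gaps, NOT summit progress.  Companion rows: cell `GAPS.md` G-pv01-5,
C-pv01-4; `DIVERGENCE.md` D-pv01.5.
-/

namespace Literature.MathematicalPhysics.QuantumFieldTheory.Balaban1983to89.B6Prop26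

open B6RandomWalk

variable {g : B6.Geometry} {X : Type}

/-- **(2.91) ⇒ the fixed-point form of (2.141)**, pure algebra: if `G Δ_a = I` (G = Δ_a^{−1}, p. 239: G_□ =
(Δ − ∂P_□∂* + Q*aQ)^{−1} (2.90), G the corresponding global inverse) and `Δ_a G₀ = I − R` (2.91), then
`G = G₀ + G R` (multiply (2.91) by G on the left). [cite: Balaban1984PropagatorsII, (2.91) p.239 + (2.141) p.247] -/
theorem fixedPoint_of_291 {G G0 R Δa : Module.End ℝ (X → ℝ)} (hinv : G * Δa = 1) (h291 : Δa * G0 = 1 - R) :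
    G = G0 + G * R := by
  have h : G * (Δa * G0) = G * (1 - R) := by rw [h291]
  rw [← mul_assoc, hinv, one_mul, mul_sub, mul_one] at h
  rw [h, sub_add_cancel]

/-- Left factors ride along: `G = G₀ + GR` gives `DG = DG₀ + (DG)R` for every linear D (D = ∇_μ, Δ for the second
and fourth entries of (2.136)). [folklore] -/
theorem left_mul_fixedPoint {G G0 R : Module.End ℝ (X → ℝ)} (D : Module.End ℝ (X → ℝ)) (hfix : G = G0 + G * R) :
    D * G = D * G0 + D * G * R := by
  conv_lhs => rw [hfix]
  rw [mul_add, mul_assoc]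

/-- **"Reasoning in the same way as in the proof of Proposition 2.2 we obtain Proposition 2.6"**, one entry of (2.136),
KERNEL-CHECKED (p. 247): on a finite lattice X with block map `blk : X → 𝔅`, if `G Δ_a = I`, `Δ_a G₀ = I − R`
((2.91)), the operator `DG₀` has the block majorant `A·P(y)·e^{−δ d(y,y′)}` ((2.133) summed over the boxes, for the
left factor D) and `R` the block majorant `θ e^{−δ d(y,y′)}` ((2.135), θ = O(M^{−1})), then — given Lemma 2.1 at
rate δ ((2.61), (2.63)), the triangle inequality, d(y,y) = 0, d ≥ 0 and the smallness θc₁(α) < 1 — `DG` has the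
block majorant `A c₁(α)(1 − θc₁(α))^{−1} P(y) e^{−(1−α)δ d(y,y′)}`: the (2.136) entry with δ₃ = (1−α)δ and O(1)
explicit.  The chain argument is `B6RandomWalk.majorant_of_fixedPoint_266` (unit pv08), invoked by name.
[cite: Balaban1984PropagatorsII, Prop. 2.6 (2.136) p.247; Prop. 2.2 (2.64)–(2.66) p.234] -/
theorem prop26_entry_of_291 [Fintype X] [DecidableEq X] (blk : X → g.Site) (d : ℕ) (δ α θ A : ℝ)
    (P : g.Site → ℝ) (hA : 0 ≤ A) (hP : ∀ y, 0 ≤ P y) (hθ : 0 ≤ θ) (hαδ : 0 ≤ (1 - α) * δ)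
    (htri : Triangle254 g) (hrefl : ∀ y : g.Site, g.dist y y = 0) (hdnn : ∀ y y' : g.Site, 0 ≤ g.dist y y')
    (h261 : Ineq261 d g δ α) (h263 : Ineq263 d g δ α) (hsmall : θ * B6.c1 d δ α < 1)
    {G G0 R Δa : Module.End ℝ (X → ℝ)} (D : Module.End ℝ (X → ℝ))
    (hinv : G * Δa = 1) (h291 : Δa * G0 = 1 - R)
    (hDG0 : HasMajorant blk (D * G0) (fun a b => A * P a * Real.exp (-(δ * g.dist a b))))
    (hR : HasMajorant blk R (fun a b => θ * Real.exp (-(δ * g.dist a b)))) :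
    HasMajorant blk (D * G)
      (fun a b => A * B6.c1 d δ α * (1 - θ * B6.c1 d δ α)⁻¹ * P a *
        Real.exp (-((1 - α) * δ * g.dist a b))) :=
  majorant_of_fixedPoint_266 blk d δ α θ A P hA hP hθ hαδ htri hrefl hdnn h261 h263 hsmall hDG0 hR
    (left_mul_fixedPoint D (fixedPoint_of_291 hinv h291))

/-- The same over the carrier of `…B6` with Lemma 2.1 TAKEN FROM THE TREE: for a geometry of a family satisfying
`B6.Lemma21Printed d δ geo` (rate δ ≥ 0) and the triangle inequality (2.54), under (2.1)–(2.2), 0 < α < 1 and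
(2.59), the inputs (2.61) and (2.63) of `prop26_entry_of_291` are DISCHARGED (`B6RandomWalk.lemma21Printed_iff`,
`B6RandomWalk.ineq263_of_261`). [cite: Balaban1984PropagatorsII, Prop. 2.6 p.247; Lemma 2.1 p.234] -/
theorem prop26_entry_of_lemma21 {I : Type} (d : ℕ) (δ : ℝ) (hδ : 0 ≤ δ) (geo : I → B6.Geometry)
    (h21 : B6.Lemma21Printed d δ geo) (i : I) (htri : Triangle254 (geo i))
    (hrefl : ∀ y : (geo i).Site, (geo i).dist y y = 0) (hdnn : ∀ y y' : (geo i).Site, 0 ≤ (geo i).dist y y')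
    (hH : (geo i).Hyp21_22) (α : ℝ) (hα0 : 0 < α) (hα1 : α < 1)
    (h259 : B6.Cond259 d δ α (geo i).R (geo i).M)
    {X : Type} [Fintype X] [DecidableEq X] (blk : X → (geo i).Site) (θ A : ℝ) (P : (geo i).Site → ℝ)
    (hA : 0 ≤ A) (hP : ∀ y, 0 ≤ P y) (hθ : 0 ≤ θ) (hsmall : θ * B6.c1 d δ α < 1)
    {G G0 R Δa : Module.End ℝ (X → ℝ)} (D : Module.End ℝ (X → ℝ))
    (hinv : G * Δa = 1) (h291 : Δa * G0 = 1 - R)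
    (hDG0 : HasMajorant blk (D * G0) (fun a b => A * P a * Real.exp (-(δ * (geo i).dist a b))))
    (hR : HasMajorant blk R (fun a b => θ * Real.exp (-(δ * (geo i).dist a b)))) :
    HasMajorant blk (D * G)
      (fun a b => A * B6.c1 d δ α * (1 - θ * B6.c1 d δ α)⁻¹ * P a *
        Real.exp (-((1 - α) * δ * (geo i).dist a b))) := by
  have h261 : Ineq261 d (geo i) δ α := ((lemma21Printed_iff d δ geo).mp h21 i hH α hα0 hα1 h259).2
  have h263 : Ineq263 d (geo i) δ α := ineq263_of_261 d (geo i) δ α htri hδ hα1.le h261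
  have hαδ : 0 ≤ (1 - α) * δ := mul_nonneg (by linarith) hδ
  exact prop26_entry_of_291 blk d δ α θ A P hA hP hθ hαδ htri hrefl hdnn h261 h263 hsmall D hinv h291 hDG0 hR

/-- **The entries n = 0, 1, 3 of (2.136) simultaneously** (the printed table [(L^jη)², L^jη, ·, 1] = `B6.pref4`, the
third entry |(G∇*J)(x)| excepted): for three left factors D₀ = 1 (the operator G itself), D₁ (∇), D₃ (Δ) whose
products with G₀ have block majorants A·[(L^jη)², L^jη, 1]·e^{−δd}, the products with G have block majorants
A c₁(α)(1 − θc₁(α))^{−1}·[(L^jη)², L^jη, 1]·e^{−(1−α)δ d} — over a geometry of a family satisfying the tree's typed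
Lemma 2.1, from ONLY (2.91), G Δ_a = I, the two majorant hypotheses, the printed side conditions, d(y,y) = 0, d ≥ 0,
1 ≤ L, 0 < η (for the signs of the powers) and the located smallness θc₁(α) < 1.
[cite: Balaban1984PropagatorsII, Prop. 2.6 (2.136) p.247] -/
theorem prop26_three_entries_of_lemma21 {I : Type} (d : ℕ) (δ : ℝ) (hδ : 0 ≤ δ) (geo : I → B6.Geometry)
    (h21 : B6.Lemma21Printed d δ geo) (i : I) (htri : Triangle254 (geo i))
    (hrefl : ∀ y : (geo i).Site, (geo i).dist y y = 0) (hdnn : ∀ y y' : (geo i).Site, 0 ≤ (geo i).dist y y')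
    (hH : (geo i).Hyp21_22) (α : ℝ) (hα0 : 0 < α) (hα1 : α < 1)
    (h259 : B6.Cond259 d δ α (geo i).R (geo i).M) (hL : 1 ≤ (geo i).L) (hη : 0 < (geo i).eta)
    {X : Type} [Fintype X] [DecidableEq X] (blk : X → (geo i).Site) (θ A : ℝ)
    (hA : 0 ≤ A) (hθ : 0 ≤ θ) (hsmall : θ * B6.c1 d δ α < 1)
    {G G0 R Δa : Module.End ℝ (X → ℝ)} (D : Fin 4 → Module.End ℝ (X → ℝ)) (hD0 : D 0 = 1)
    (hinv : G * Δa = 1) (h291 : Δa * G0 = 1 - R)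
    (hDG0 : ∀ n : Fin 4, n ≠ 2 → HasMajorant blk (D n * G0)
      (fun a b => A * B6.pref4 ((geo i).len a) n * Real.exp (-(δ * (geo i).dist a b))))
    (hR : HasMajorant blk R (fun a b => θ * Real.exp (-(δ * (geo i).dist a b)))) :
    (HasMajorant blk G
      (fun a b => A * B6.c1 d δ α * (1 - θ * B6.c1 d δ α)⁻¹ * ((geo i).len a) ^ 2 *
        Real.exp (-((1 - α) * δ * (geo i).dist a b)))) ∧
    (∀ n : Fin 4, n ≠ 2 → HasMajorant blk (D n * G)
      (fun a b => A * B6.c1 d δ α * (1 - θ * B6.c1 d δ α)⁻¹ * B6.pref4 ((geo i).len a) n *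
        Real.exp (-((1 - α) * δ * (geo i).dist a b)))) := by
  have hlen : ∀ y : (geo i).Site, 0 ≤ (geo i).len y := fun y => by
    unfold B6.Geometry.len
    exact mul_nonneg (pow_nonneg (le_trans zero_le_one hL) _) hη.le
  have hpref : ∀ (n : Fin 4) (y : (geo i).Site), 0 ≤ B6.pref4 ((geo i).len y) n := by
    intro n y
    have h := hlen y
    fin_cases n <;> simp [B6.pref4] <;> positivity
  have hall : ∀ n : Fin 4, n ≠ 2 → HasMajorant blk (D n * G)
      (fun a b => A * B6.c1 d δ α * (1 - θ * B6.c1 d δ α)⁻¹ * B6.pref4 ((geo i).len a) n *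
        Real.exp (-((1 - α) * δ * (geo i).dist a b))) := fun n hn =>
    prop26_entry_of_lemma21 d δ hδ geo h21 i htri hrefl hdnn hH α hα0 hα1 h259 blk θ A
      (fun y => B6.pref4 ((geo i).len y) n) hA (hpref n) hθ hsmall (D n) hinv h291 (hDG0 n hn) hR
  refine ⟨?_, hall⟩
  have h0 := hall 0 (by decide)
  rw [hD0, one_mul] at h0
  refine hasMajorant_mono blk h0 fun a b => le_of_eq ?_
  simp [B6.pref4]

end Literature.MathematicalPhysics.QuantumFieldTheory.Balaban1983to89.B6Prop26
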